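import Summits.HodgeConjecture.HodgeConjecture.Theses.HolomorphicityRate
import Literature.AlgebraicGeometry.HodgeTheory.HodgeTypeDimension

/-!
# Route HolomorphicityRate — `TargetSuffices` (item stmt-HodgeConjecture-2743)

Pure-logic glue: the route target `Target` (for `X` smooth projective of dimension `n`, `p ≤ n`, a Hodge
model `A` and a rational class `c` with `A.pullback c` of type `(p,p)`, some `m•c + b` with `m ≥ 1` and
`b` algebraic dies off a closed analytic `S ⊆ X^an` whose regular points have codimension `≥ p`), the
Chow/GAGA bridge `AnalyticSupportAlgebraic` and the anti-vacuity conjunct `HodgeModelsExist` imply the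
sub-problem statement `HodgeConjecture`.  No mathematical content beyond `ℂ`-submodule arithmetic and
the vanishing of `(p,p)`-classes in degree `2p > 2n` (`IsOfHodgeType.eq_zero_pp_of_lt`).
-/

-- `Summit.HodgeConjecture.HodgeConjecture.Theorems` is the mandated namespace (single-problem summit:
-- Problem = Summit), which `linter.dupNamespace` flags on every declaration; the lakefile turns the
-- linter off for the Summits library (weak option), restated here so stand-alone elaboration is warning-free.
set_option linter.dupNamespace false

namespace Summit.HodgeConjecture.HodgeConjecture.Theorems

/-- **Item stmt-HodgeConjecture-2743 (`TargetSuffices`)**: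
`Target → AnalyticSupportAlgebraic → HodgeModelsExist → HodgeConjecture`.
For `p ≤ n`: take the Hodge model `A` in which `c` is `(p,p)` (the witness of `IsOfHodgeType`), let
`Target` give `m ≥ 1`, an algebraic `b` and a closed analytic `S` (regular points of codimension `≥ p`)
off which `m•c + b` dies; `AnalyticSupportAlgebraic` (Chow/GAGA) makes `m•c + b` algebraic; subtract
`b ∈ Nᵖ H²ᵖ` and divide by `m ≠ 0` (`algebraicClasses X p` is a `ℂ`-submodule).  For `p > n` the class
is `0` (`IsOfHodgeType.eq_zero_pp_of_lt`).  The existence conjunct of `HodgeConjectureFor` is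
`HodgeModelsExist`.  The type is literally the route decl
`Summit.HodgeConjecture.HodgeConjecture.Theses.HolomorphicityRate.TargetSuffices`. -/
theorem TargetSuffices_proof :
    Summit.HodgeConjecture.HodgeConjecture.Theses.HolomorphicityRate.TargetSuffices := by
  unfold Summit.HodgeConjecture.HodgeConjecture.Theses.HolomorphicityRate.TargetSuffices
  intro hT hASA hHM n X hX
  refine ⟨hHM n X hX, fun p c hc hH ↦ ?_⟩
  rcases le_or_gt p n with hp | hp
  · -- `p ≤ n`: run `Target` in a model where `c` is `(p,p)`, apply Chow/GAGA, subtract `b`, divide by `m`.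
    obtain ⟨A, hA⟩ := hH
    obtain ⟨m, b, S, hm, hb, hS, hsupp⟩ := hT n p X hX hp A c hc hA
    have hmem : ((m : ℂ) • c + b) ∈
        Literature.AlgebraicGeometry.HodgeTheory.algebraicClasses X p :=
      hASA n p X hX A _ S hS hsupp
    have hmc : ((m : ℂ) • c) ∈ Literature.AlgebraicGeometry.HodgeTheory.algebraicClasses X p := by
      have h := Submodule.sub_mem _ hmem hb
      rwa [add_sub_cancel_right] at h
    have hm0 : (m : ℂ) ≠ 0 := Nat.cast_ne_zero.2 hm.ne'
    have h := Submodule.smul_mem _ ((m : ℂ)⁻¹) hmc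
    rwa [smul_smul, inv_mul_cancel₀ hm0, one_smul] at h
  · -- `n < p`: the class is zero.
    rw [hH.eq_zero_pp_of_lt hp]
    exact Submodule.zero_mem _

end Summit.HodgeConjecture.HodgeConjecture.Theorems
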